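import Summits.BirchSwinnertonDyer.BirchSwinnertonDyer.Theorems.AlignedTransportAtTwoMainConjectureTransportAlignedAtTwoNegTwistTransform
import HarnessLib

/-!
# Route `AlignedTransportAtTwo`, crux C1 `MainConjectureTransportAlignedAtTwo` (stmt-BirchSwinnertonDyer-22296), line `birth` — NEGATIVE twists,
# measure / transform level in SHARED-PRIMES form: the chain of `…NegTwistMeasure.lean` §1–§2 and `…NegTwistTransform.lean` §3 with (i) the
# integer slack required only at cusps of denominator prime to `m·N` and (ii) the tame bound `‖μ_{f,α,m}‖₂ ≤ 2` as a HYPOTHESIS — so that it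
# applies at a tame level `m` meeting `N` in primes `ℓ ∥ N` (core MULTIPLICATIVE at primes of `d`; bound = `norm_msdMeasureTame_two_le_two_sqfreeAt`)

HONEST FRAMING (cell `bsd-f1-sign2`, lead seat `bsd-line-att-p1` g7). BSD is NOT proved; C1 is NOT closed. THEOREMS ONLY; nothing asserted;
`--supports stmt-BirchSwinnertonDyer-22296 --as helper`. Proofs = the coprime versions verbatim (the measure lemma only ever used the slack at the
cusps `a/2ⁿ`, `2a/2ⁿ`, whose denominators are prime to any odd modulus).

* §1 `exists_msdMeasure_twist_eq_sum_msdMeasureTame_add_shared` · §2 `norm_padicLRiemannSum_twist_sub_half_le_shared` ·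
  §3 **`exists_padicLFunction_twist_eq_add_two_mul_shared`** — `L₂(g, χ(2)α) = C(c)·(1+T)^{−f_m}·L₂(f, m, α, 𝟙_m) + C(2c)·ι(E)`, `E ∈ Λ`.

References: [MazurTateTeitelbaum1986Invent] §I.8, §I.10, §I.13; [Matsuno2000] Lemmas 3.2–3.3 (pp. 86–88).
-/

set_option autoImplicit false
set_option linter.dupNamespace false

noncomputable section

open scoped Classical MatrixGroups ModularForm

open CongruenceSubgroup Filter Topology PowerSeries
open Literature.NumberTheory.EllipticCurves Literature.NumberTheory.EllipticCurves.ModularForms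
  Literature.NumberTheory.EllipticCurves.GreenbergVatsal2000
open Summit.BirchSwinnertonDyer.BirchSwinnertonDyer.Theorems.AlignedTransportAtTwoNegTwistMeasure

namespace Summit.BirchSwinnertonDyer.BirchSwinnertonDyer.Theorems.AlignedTransportAtTwoNegTwistMeasureShared

/-! ## §1 Measure level (slack at cusps prime to `m·N`) -/

section Measure

variable {N N' : ℕ} [NeZero N] [NeZero N'] (f : CuspForm (Gamma0 N) 2) (g : CuspForm (Gamma0 N') 2)
  {m : ℕ} [NeZero m]

omit [NeZero N] [NeZero N'] [NeZero m] in
/-- The denominator of `j·a/2ⁿ` is prime to an odd `M`; private helper. [folklore] -/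
private theorem coprime_den_natCast_div_two_pow {M : ℕ} (h2N : ¬ 2 ∣ M) (j a n : ℕ) :
    Nat.Coprime ((j : ℚ) * ((a : ℚ) / (2 : ℚ) ^ n)).den M := by
  have h := Rat.den_dvd ((j * a : ℕ) : ℤ) ((2 : ℤ) ^ n)
  rw [Rat.divInt_eq_div] at h
  push_cast at h
  have e : (j : ℚ) * ((a : ℚ) / (2 : ℚ) ^ n) = (j : ℚ) * a / 2 ^ n := by ring
  rw [e]
  have h' : ((j : ℚ) * a / 2 ^ n).den ∣ 2 ^ n := by exact_mod_cast h
  exact Nat.Coprime.coprime_dvd_left h' (Nat.Coprime.pow_left n ((Nat.Prime.coprime_iff_not_dvd Nat.prime_two).mpr h2N))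

omit [NeZero N'] in
/-- **Birch's lemma at the level of the measures, UP TO INTEGERS — slack required only at cusps of denominator prime to `m·N`** (shared-primes
twin of `…NegTwistMeasure.exists_msdMeasure_twist_eq_sum_msdMeasureTame_add`). Let `χ` be a `ℚ`-valued character mod `m`, `(m, 2) = 1`,
`χ(2)² = 1`, `c ∈ ℚ`, `α ∈ ℚ₂` with `‖α⁻¹‖ ≤ 1`, and assume `[x]⁺_g = c·(Σ_{b mod m} χ(b)[x + b/m]⁺_f + k_x)` with `k_x ∈ ℤ` for every `x` of
denominator prime to `m·N` (`N` odd). Then for every `n`, `a mod 2ⁿ`: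
`μ_{g, χ(2)α}(a + 2ⁿℤ₂) = c·Σ_{b mod m} χ(b)·μ_{f,α,m}((a·m + 2ⁿℤ₂) × {b}) + c·e` with `‖e‖₂ ≤ 1` (`e = (χ(2)α)⁻ⁿk₁ − (χ(2)α)⁻ⁿ⁻¹k₂`). The tree's
`msdMeasure_twist_eq_sum_msdMeasureTame` (exact relation) with the slack carried along.
[cite: MazurTateTeitelbaum1986Invent, §I.8–I.10 (pp. 10–13)] [cite: Matsuno2000, §2 (p. 84)] -/
theorem exists_msdMeasure_twist_eq_sum_msdMeasureTame_add_shared (hm2 : m.Coprime 2) (h2N : ¬ 2 ∣ N) (χ : MulChar (ZMod m) ℚ)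
    (hχ2 : χ (2 : ZMod m) ^ 2 = 1) {c : ℚ}
    (hBk : ∀ x : ℚ, Nat.Coprime x.den (m * N) →
      ∃ k : ℤ, ratPlusSymbol g x = c * (∑ b : ZMod m, χ b * ratPlusSymbol f (x + (b.val : ℚ) / m) + k))
    {α : ℚ_[2]} (hα : ‖α⁻¹‖ ≤ 1) (n : ℕ) (a : ZMod (2 ^ n)) :
    ∃ e : ℚ_[2], ‖e‖ ≤ 1 ∧
      msdMeasure g (((χ (2 : ZMod m) : ℚ) : ℚ_[2]) * α) n a =
        (c : ℚ_[2]) * ∑ b : ZMod m, ((χ b : ℚ) : ℚ_[2]) * msdMeasureTame f m α n (a * (m : ZMod (2 ^ n))) b + (c : ℚ_[2]) * e := by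
  have hχ21 : χ (2 : ZMod m) ≠ 0 := by
    intro h; rw [h] at hχ2; norm_num at hχ2
  have hinv : (((χ (2 : ZMod m) : ℚ) : ℚ_[2]))⁻¹ = ((χ (2 : ZMod m) : ℚ) : ℚ_[2]) := by
    have h2 : ((χ (2 : ZMod m) : ℚ) : ℚ_[2]) * ((χ (2 : ZMod m) : ℚ) : ℚ_[2]) = 1 := by
      rw [← Rat.cast_mul, ← pow_two, hχ2, Rat.cast_one]
    exact inv_eq_of_mul_eq_one_right h2
  have hnormχ : ‖((χ (2 : ZMod m) : ℚ) : ℚ_[2])‖ = 1 := by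
    have h2 : ‖((χ (2 : ZMod m) : ℚ) : ℚ_[2])‖ ^ 2 = 1 := by
      rw [← norm_pow, ← Rat.cast_pow, hχ2, Rat.cast_one, norm_one]
    exact (pow_eq_one_iff_of_nonneg (norm_nonneg _) two_ne_zero).mp h2
  have hpow : ∀ n : ℕ, χ ((2 : ZMod m) ^ n) = χ (2 : ZMod m) ^ n := fun n ↦ map_pow χ _ n
  set α' : ℚ_[2] := ((χ (2 : ZMod m) : ℚ) : ℚ_[2]) * α with hα'
  have hα'i : ‖α'⁻¹‖ ≤ 1 := by
    rw [hα', mul_inv, norm_mul, hinv, hnormχ, one_mul]; exact hα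
  -- the two points `x₁ = a/2ⁿ`, `x₂ = 2a/2ⁿ` and their integer slacks (denominators prime to the odd `m·N`)
  have h2mN : ¬ 2 ∣ m * N := by
    intro h
    rcases (Nat.Prime.dvd_mul Nat.prime_two).mp h with h | h
    · exact (Nat.coprime_two_right.mp hm2 |> Nat.not_even_iff_odd.mpr) (even_iff_two_dvd.mpr h)
    · exact h2N h
  have hx₁ : Nat.Coprime (((a.val : ℚ) / (2 : ℚ) ^ n)).den (m * N) := by
    have h := coprime_den_natCast_div_two_pow h2mN 1 a.val n
    rwa [Nat.cast_one, one_mul] at h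
  have hx₂ : Nat.Coprime (((2 : ℚ) * ((a.val : ℚ) / (2 : ℚ) ^ n))).den (m * N) := by
    have h := coprime_den_natCast_div_two_pow h2mN 2 a.val n
    rwa [Nat.cast_ofNat] at h
  obtain ⟨k₁, hk₁⟩ := hBk _ hx₁
  obtain ⟨k₂, hk₂⟩ := hBk _ hx₂
  have hp2 : ((2 : ℕ) : ℚ) = (2 : ℚ) := by norm_num
  -- the two Birch sums over the tame fractions, cast to `ℚ₂`
  have key1 : (c : ℚ_[2]) * ∑ b : ZMod m, ((χ b : ℚ) : ℚ_[2]) *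
      (ratPlusSymbol f (tameFraction 2 m n (a * (m : ZMod (2 ^ n))) b) : ℚ_[2]) =
      ((χ (2 : ZMod m) : ℚ) : ℚ_[2]) ^ n *
        ((ratPlusSymbol g ((a.val : ℚ) / (2 : ℚ) ^ n) : ℚ_[2]) - (c : ℚ_[2]) * (k₁ : ℚ_[2])) := by
    have h := sum_mul_ratPlusSymbol_tameFraction_eq f hm2 χ n a
    simp only [Nat.cast_ofNat] at h
    rw [hpow] at h
    have h' := congrArg (fun q : ℚ ↦ ((c * q : ℚ) : ℚ_[2])) h
    have hk : (ratPlusSymbol g ((a.val : ℚ) / (2 : ℚ) ^ n) : ℚ_[2]) - (c : ℚ_[2]) * (k₁ : ℚ_[2]) =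
        ((c * ∑ b : ZMod m, χ b * ratPlusSymbol f ((a.val : ℚ) / (2 : ℚ) ^ n + (b.val : ℚ) / m) : ℚ) : ℚ_[2]) := by
      rw [hk₁]; push_cast; ring
    rw [hk]
    push_cast at h' ⊢
    rw [h']
    ring
  have key2 : (c : ℚ_[2]) * ∑ b : ZMod m, ((χ b : ℚ) : ℚ_[2]) *
      (ratPlusSymbol f ((2 : ℚ) * tameFraction 2 m n (a * (m : ZMod (2 ^ n))) b) : ℚ_[2]) =
      ((χ (2 : ZMod m) : ℚ) : ℚ_[2]) ^ (n + 1) *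
        ((ratPlusSymbol g ((2 : ℚ) * ((a.val : ℚ) / (2 : ℚ) ^ n)) : ℚ_[2]) - (c : ℚ_[2]) * (k₂ : ℚ_[2])) := by
    have h := sum_mul_ratPlusSymbol_prime_mul_tameFraction_eq f hm2 χ n a
    simp only [Nat.cast_ofNat] at h
    rw [hpow] at h
    have h1 : ∑ b : ZMod m, χ b * ratPlusSymbol f ((2 : ℚ) * tameFraction 2 m n (a * (m : ZMod (2 ^ n))) b) =
        χ (2 : ZMod m) ^ (n + 1) *
          ∑ b : ZMod m, χ b * ratPlusSymbol f ((2 : ℚ) * ((a.val : ℚ) / (2 : ℚ) ^ n) + (b.val : ℚ) / m) := by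
      have := congrArg (fun q ↦ χ (2 : ZMod m) * q) h
      rw [← mul_assoc, ← pow_two, hχ2, one_mul] at this
      rw [this]
      ring
    have h' := congrArg (fun q : ℚ ↦ ((c * q : ℚ) : ℚ_[2])) h1
    have hk : (ratPlusSymbol g ((2 : ℚ) * ((a.val : ℚ) / (2 : ℚ) ^ n)) : ℚ_[2]) - (c : ℚ_[2]) * (k₂ : ℚ_[2]) =
        ((c * ∑ b : ZMod m, χ b * ratPlusSymbol f ((2 : ℚ) * ((a.val : ℚ) / (2 : ℚ) ^ n) + (b.val : ℚ) / m) : ℚ) : ℚ_[2]) := by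
      rw [hk₂]; push_cast; ring
    rw [hk]
    push_cast at h' ⊢
    rw [h']
    ring
  refine ⟨α'⁻¹ ^ n * (k₁ : ℚ_[2]) - α'⁻¹ ^ (n + 1) * (k₂ : ℚ_[2]), ?_, ?_⟩
  · have hA : ‖α'⁻¹ ^ n * (k₁ : ℚ_[2])‖ ≤ 1 := by
      rw [norm_mul, norm_pow]
      exact mul_le_one₀ (pow_le_one₀ (norm_nonneg _) hα'i) (norm_nonneg _) (Padic.norm_int_le_one k₁)
    have hB : ‖α'⁻¹ ^ (n + 1) * (k₂ : ℚ_[2])‖ ≤ 1 := by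
      rw [norm_mul, norm_pow]
      exact mul_le_one₀ (pow_le_one₀ (norm_nonneg _) hα'i) (norm_nonneg _) (Padic.norm_int_le_one k₂)
    rw [sub_eq_add_neg]
    exact (Padic.nonarchimedean _ _).trans (max_le hA (by rw [norm_neg]; exact hB))
  -- expand the right-hand side
  have hRHS : (c : ℚ_[2]) * ∑ b : ZMod m, ((χ b : ℚ) : ℚ_[2]) * msdMeasureTame f m α n (a * (m : ZMod (2 ^ n))) b =
      α⁻¹ ^ n * ((c : ℚ_[2]) * ∑ b : ZMod m, ((χ b : ℚ) : ℚ_[2]) *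
        (ratPlusSymbol f (tameFraction 2 m n (a * (m : ZMod (2 ^ n))) b) : ℚ_[2])) -
      α⁻¹ ^ (n + 1) * ((c : ℚ_[2]) * ∑ b : ZMod m, ((χ b : ℚ) : ℚ_[2]) *
        (ratPlusSymbol f ((2 : ℚ) * tameFraction 2 m n (a * (m : ZMod (2 ^ n))) b) : ℚ_[2])) := by
    simp only [msdMeasureTame, hp2, Finset.mul_sum, ← Finset.sum_sub_distrib]
    refine Finset.sum_congr rfl fun b _ ↦ ?_
    ring
  rw [hRHS, key1, key2]
  cases n with
  | zero =>
    have ha : a.val = 0 := by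
      have h1 : a.val < 2 ^ 0 := ZMod.val_lt a
      have h2 : 2 ^ 0 = 1 := rfl
      omega
    simp only [msdMeasure, ha, Nat.cast_zero, zero_div, mul_zero, pow_zero, one_mul, zero_add, pow_one, mul_inv, hinv, hα']
    ring
  | succ n =>
    have hx : (2 : ℚ) * ((a.val : ℚ) / (2 : ℚ) ^ (n + 1)) = (a.val : ℚ) / (2 : ℚ) ^ n := by
      rw [pow_succ (2 : ℚ) n]; field_simp
    have hp2' : ((2 : ℕ) : ℚ) = (2 : ℚ) := by norm_num
    simp only [msdMeasure, hp2', hx, mul_inv, inv_pow, hinv, hα']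
    ring

end Measure

/-! ## §2 The `η = 1` half-sum comparison -/

section Half

variable {N N' : ℕ} [NeZero N] [NeZero N'] (f : CuspForm (Gamma0 N) 2) (g : CuspForm (Gamma0 N') 2)
  {m : ℕ} [NeZero m]

/-- **The Riemann sums of the twist vs the `η = 1` HALF of the translated depleted tame sums — shared-primes form** (`‖μ_{f,α,m}‖₂ ≤ 2` as a
hypothesis, slack required only at cusps prime to `m·N`): under the hypotheses of §1 with `N` odd, `(m, 2) = 1`, `‖α⁻¹‖ ≤ 1` and `χ(b)² = 1` on
units: for every `k, n`,
`‖R_g(k,n) − 2c·Σ_{s mod 2ⁿ} ν_𝟙(m·5ˢ + 2ⁿ⁺²ℤ₂)·C(s,k)‖₂ ≤ ‖2c‖₂`, where `R_g(k,n) = padicLRiemannSum g (χ(2)α) k n` and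
`ν_𝟙(y) = Σ_b 𝟙_m(b)·μ_{f,α,m}(y × {b})` (`R_g = 2·Σ_s μ_g(5ˢ)C(s,k)` by the Δ-doubling `padicLRiemannSum_two`; §1 termwise; character half §2).
[cite: MazurTateTeitelbaum1986Invent, §I.13 (p = 2: Δ = {±1}, γ = 5)] [cite: Matsuno2000, Lemmas 3.2–3.3 (pp. 87–88)] -/
theorem norm_padicLRiemannSum_twist_sub_half_le_shared (h2N : ¬ 2 ∣ N) (hm2 : m.Coprime 2) {α : ℚ_[2]} (hα : ‖α⁻¹‖ ≤ 1)
    (hμ : ∀ (n : ℕ) (a : ZMod (2 ^ n)) (b : ZMod m), ‖msdMeasureTame f m α n a b‖ ≤ 2)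
    (χ : MulChar (ZMod m) ℚ) (hχ2 : χ (2 : ZMod m) ^ 2 = 1)
    (hχv : ∀ b : ZMod m, IsUnit b → χ b ^ 2 = 1) {c : ℚ}
    (hBk : ∀ x : ℚ, Nat.Coprime x.den (m * N) →
      ∃ k : ℤ, ratPlusSymbol g x = c * (∑ b : ZMod m, χ b * ratPlusSymbol f (x + (b.val : ℚ) / m) + k))
    (k n : ℕ) :
    ‖padicLRiemannSum g (((χ (2 : ZMod m) : ℚ) : ℚ_[2]) * α) k n -
      2 * (c : ℚ_[2]) * ∑ s : ZMod (2 ^ n), (∑ b : ZMod m, (1 : DirichletCharacter ℚ_[2] m) b *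
        msdMeasureTame f m α (n + 2) ((cyclotomicGenerator 2 : ZMod (2 ^ (n + 2))) ^ s.val * (m : ZMod (2 ^ (n + 2)))) b) *
        (s.val.choose k : ℚ_[2])‖ ≤ ‖(2 * c : ℚ_[2])‖ := by
  -- termwise: §1 and the character half
  have hterm : ∀ s : ZMod (2 ^ n), ∃ e : ℚ_[2], ‖e‖ ≤ 1 ∧
      msdMeasure g (((χ (2 : ZMod m) : ℚ) : ℚ_[2]) * α) (n + 2) ((cyclotomicGenerator 2 : ZMod (2 ^ (n + 2))) ^ s.val) =
        (c : ℚ_[2]) * ∑ b : ZMod m, (1 : DirichletCharacter ℚ_[2] m) b *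
          msdMeasureTame f m α (n + 2) ((cyclotomicGenerator 2 : ZMod (2 ^ (n + 2))) ^ s.val * (m : ZMod (2 ^ (n + 2)))) b +
        (c : ℚ_[2]) * e := by
    intro s
    obtain ⟨e, he, hμg⟩ := exists_msdMeasure_twist_eq_sum_msdMeasureTame_add_shared f g hm2 h2N χ hχ2 hBk hα (n + 2)
      ((cyclotomicGenerator 2 : ZMod (2 ^ (n + 2))) ^ s.val)
    set D : ℚ_[2] := ∑ b : ZMod m, ((χ b : ℚ) : ℚ_[2]) *
        msdMeasureTame f m α (n + 2) ((cyclotomicGenerator 2 : ZMod (2 ^ (n + 2))) ^ s.val * (m : ZMod (2 ^ (n + 2)))) b -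
      ∑ b : ZMod m, (1 : DirichletCharacter ℚ_[2] m) b *
        msdMeasureTame f m α (n + 2) ((cyclotomicGenerator 2 : ZMod (2 ^ (n + 2))) ^ s.val * (m : ZMod (2 ^ (n + 2)))) b with hD
    have hDn : ‖D‖ ≤ 1 := norm_weighted_sub_weighted_one_le_one χ hχv _ fun b ↦ hμ _ _ b
    refine ⟨D + e, (Padic.nonarchimedean _ _).trans (max_le hDn he), ?_⟩
    rw [hμg, hD]
    ring
  choose e he hμg using hterm
  rw [padicLRiemannSum_two, Finset.sum_congr rfl fun s _ ↦ by rw [hμg s]]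
  have hsplit : 2 * ∑ s : ZMod (2 ^ n), ((c : ℚ_[2]) * ∑ b : ZMod m, (1 : DirichletCharacter ℚ_[2] m) b *
        msdMeasureTame f m α (n + 2) ((cyclotomicGenerator 2 : ZMod (2 ^ (n + 2))) ^ s.val * (m : ZMod (2 ^ (n + 2)))) b +
        (c : ℚ_[2]) * e s) * (s.val.choose k : ℚ_[2]) -
      2 * (c : ℚ_[2]) * ∑ s : ZMod (2 ^ n), (∑ b : ZMod m, (1 : DirichletCharacter ℚ_[2] m) b *
        msdMeasureTame f m α (n + 2) ((cyclotomicGenerator 2 : ZMod (2 ^ (n + 2))) ^ s.val * (m : ZMod (2 ^ (n + 2)))) b) *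
        (s.val.choose k : ℚ_[2]) =
      (2 * c : ℚ_[2]) * ∑ s : ZMod (2 ^ n), e s * (s.val.choose k : ℚ_[2]) := by
    rw [Finset.mul_sum, Finset.mul_sum, Finset.mul_sum, ← Finset.sum_sub_distrib]
    refine Finset.sum_congr rfl fun s _ ↦ ?_
    ring
  rw [hsplit, norm_mul]
  refine mul_le_of_le_one_right (norm_nonneg _) ?_
  refine IsUltrametricDist.norm_sum_le_of_forall_le_of_nonneg zero_le_one fun s _ ↦ ?_
  rw [norm_mul]
  have hnat : ‖((s.val.choose k : ℕ) : ℚ_[2])‖ ≤ 1 := by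
    simpa using Padic.norm_int_le_one (p := 2) (s.val.choose k : ℤ)
  exact mul_le_one₀ (he s) (norm_nonneg _) hnat


end Half

/-! ## §3 The transform congruence -/

section Transform

variable {N N' : ℕ} [NeZero N] [NeZero N'] (f : CuspForm (Gamma0 N) 2) (g : CuspForm (Gamma0 N') 2)
  {m : ℕ} [NeZero m]

/-- **THE ODD-TWIST TRANSFORM CONGRUENCE — shared-primes form** (`‖μ_{f,α,m}‖₂ ≤ 2` as a hypothesis; slack required only at cusps prime to `m·N`).
Let `f ∈ S₂(Γ₀(N))` be a rational normalised newform of odd level, `(m, 2) = 1`,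
`α ∈ ℚ₂` a root of `X² − a₂(f)X + 2` with `‖α‖ = 1`, `χ` a `ℚ`-valued character mod `m` with `χ(2)² = 1` and `χ(b)² = 1` on units, `c ∈ ℚ`,
and `g` a weight-`2` form whose plus symbols satisfy Birch's relation UP TO INTEGERS `[x]⁺_g = c·(Σ_b χ(b)[x + b/m]⁺_f + k_x)` at every `x` of
denominator prime to `N`, and whose `2`-adic Riemann sums at `χ(2)α` converge (`hTg`). Then there is `E ∈ Λ = ℤ₂⟦T⟧` with
`L₂(g, χ(2)α, T) = C(c)·(1+T)^{−f_m}·L₂(f, m, α, 𝟙_m, T) + C(2c)·ι(E)` — i.e. `L₂(g) ≡ C(c)·(1+T)^{−f_m}·(m-DEPLETED L₂(f)) (mod 2c·Λ)`,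
`f_m = frobeniusExponent 2 m`. Limit of §2 (`tendsto_riemannSum_translate` for the `𝟙_m`-weighted tame measure translated by `m`; the slack stays
in the closed ball). [cite: MazurTateTeitelbaum1986Invent, §I.8–I.13 (pp. 10–19)] [cite: Matsuno2000, Lemmas 3.2–3.3 and proof of Thm. 3.1 (pp. 86–88)] -/
theorem exists_padicLFunction_twist_eq_add_two_mul_shared (hf : IsNewform0 f) (hQ : coeffField f = ⊥) (h2N : ¬ 2 ∣ N)
    (hm2 : m.Coprime 2) {a₂ : ℤ} (ha₂ : cuspCoeff f 2 = a₂) {α : ℚ_[2]}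
    (hroot : α ^ 2 - a₂ * α + 2 = 0) (hαu : ‖α‖ = 1)
    (hμ : ∀ (n : ℕ) (a : ZMod (2 ^ n)) (b : ZMod m), ‖msdMeasureTame f m α n a b‖ ≤ 2)
    (χ : MulChar (ZMod m) ℚ) (hχ2 : χ (2 : ZMod m) ^ 2 = 1)
    (hχv : ∀ b : ZMod m, IsUnit b → χ b ^ 2 = 1) {c : ℚ}
    (hBk : ∀ x : ℚ, Nat.Coprime x.den (m * N) →
      ∃ k : ℤ, ratPlusSymbol g x = c * (∑ b : ZMod m, χ b * ratPlusSymbol f (x + (b.val : ℚ) / m) + k))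
    (hTg : ∀ k : ℕ, Tendsto (padicLRiemannSum g (((χ (2 : ZMod m) : ℚ) : ℚ_[2]) * α) k) atTop
      (𝓝 (padicLCoeff g (((χ (2 : ZMod m) : ℚ) : ℚ_[2]) * α) k))) :
    ∃ E : IwasawaAlgebra 2, padicLFunction g (((χ (2 : ZMod m) : ℚ) : ℚ_[2]) * α) =
      C (c : ℚ_[2]) * PowerSeries.binomialSeries ℚ_[2] (-frobeniusExponent 2 (m : ℤ_[2])) *
        padicLFunctionTame f m α (1 : DirichletCharacter ℚ_[2] m) +
      C (2 * c : ℚ_[2]) * iwasawaToPowerSeries 2 E := by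
  classical
  set α' : ℚ_[2] := ((χ (2 : ZMod m) : ℚ) : ℚ_[2]) * α with hα'def
  have hα0 : α ≠ 0 := norm_ne_zero_iff.mp (by rw [hαu]; exact one_ne_zero)
  have hα : ‖α⁻¹‖ ≤ 1 := by rw [norm_inv, hαu, inv_one]
  set χ₁ : DirichletCharacter ℚ_[2] m := 1 with hχ₁
  -- the translated `𝟙_m`-weighted tame Riemann sums and their limit (as in the tree's `padicLCoeff_twist_eq`)
  have hdist := sum_filter_weighted_msdMeasureTame_succ f hf (fun r ↦ ratCast_ratPlusSymbol_holds hf hQ r) h2N hm2 ha₂ hα0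
    hroot χ₁
  obtain ⟨Cb, hCb⟩ := exists_norm_weighted_msdMeasureTame_le f
    (exists_nsmul_modularSymbol_mem_periodLattice_of_isNewform0 hf hQ) hαu χ₁
  obtain ⟨teich, hc⟩ := exists_teichmuller_frobeniusExponent 2 hm2
  have hRSdef : ∀ k n : ℕ, padicLRiemannSumTame f m α χ₁ k n =
      ∑ᶠ zz : rootsOfUnity (torsionOrder 2) ℤ_[2], ∑ s : ZMod (2 ^ n),
        (fun (n : ℕ) (a : ZMod (2 ^ n)) ↦ ∑ b : ZMod m, χ₁ b * msdMeasureTame f m α n a b)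
          (n + cyclotomicExponent 2)
          (PadicInt.toZModPow (n + cyclotomicExponent 2) ((zz : ℤ_[2]ˣ) : ℤ_[2]) *
            (cyclotomicGenerator 2 : ZMod (2 ^ (n + cyclotomicExponent 2))) ^ s.val) *
          (s.val.choose k : ℚ_[2]) :=
    fun k n ↦ padicLRiemannSumTame_eq_sum_weighted f α χ₁ k n
  set RSz : ℕ → ℕ → ℚ_[2] := fun k n ↦ ∑ᶠ zz : rootsOfUnity (torsionOrder 2) ℤ_[2], ∑ s : ZMod (2 ^ n),
        (fun (n : ℕ) (a : ZMod (2 ^ n)) ↦ ∑ b : ZMod m, χ₁ b * msdMeasureTame f m α n a b)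
          (n + cyclotomicExponent 2)
          ((PadicInt.toZModPow (n + cyclotomicExponent 2) ((teich : ℤ_[2]ˣ) : ℤ_[2]) *
              (cyclotomicGenerator 2 : ZMod (2 ^ (n + cyclotomicExponent 2))) ^
                (PadicInt.toZModPow n (frobeniusExponent 2 (m : ℤ_[2]))).val) *
            (PadicInt.toZModPow (n + cyclotomicExponent 2) ((zz : ℤ_[2]ˣ) : ℤ_[2]) *
              (cyclotomicGenerator 2 : ZMod (2 ^ (n + cyclotomicExponent 2))) ^ s.val)) *
          ((s.val.choose k : ℕ) : ℚ_[2]) with hRSz_def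
  have hRSz : ∀ k n : ℕ, RSz k n = ∑ᶠ zz : rootsOfUnity (torsionOrder 2) ℤ_[2], ∑ s : ZMod (2 ^ n),
        (fun (n : ℕ) (a : ZMod (2 ^ n)) ↦ ∑ b : ZMod m, χ₁ b * msdMeasureTame f m α n a b)
          (n + cyclotomicExponent 2)
          ((PadicInt.toZModPow (n + cyclotomicExponent 2) ((teich : ℤ_[2]ˣ) : ℤ_[2]) *
              (cyclotomicGenerator 2 : ZMod (2 ^ (n + cyclotomicExponent 2))) ^
                (PadicInt.toZModPow n (frobeniusExponent 2 (m : ℤ_[2]))).val) *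
            (PadicInt.toZModPow (n + cyclotomicExponent 2) ((zz : ℤ_[2]ˣ) : ℤ_[2]) *
              (cyclotomicGenerator 2 : ZMod (2 ^ (n + cyclotomicExponent 2))) ^ s.val)) *
          ((s.val.choose k : ℕ) : ℚ_[2]) := fun k n ↦ by rw [hRSz_def]
  -- the limit `ℓ_k` of the translated sums
  set ℓ : ℕ → ℚ_[2] := fun k ↦ ∑ i ∈ Finset.range (k + 1),
      algebraMap ℤ_[2] ℚ_[2] (Ring.choose (-frobeniusExponent 2 (m : ℤ_[2])) (k - i)) *
        limUnder atTop (fun n ↦ padicLRiemannSumTame f m α χ₁ i n) with hℓ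
  have hlim : ∀ k, Tendsto (fun n ↦ RSz k n) atTop (𝓝 (ℓ k)) := fun k ↦ tendsto_riemannSum_translate hdist hCb hRSdef hRSz k
  -- the finite-level comparison `‖R_g − c·RSz‖ ≤ ‖2c‖`
  have hbound : ∀ k n, ‖padicLRiemannSum g α' k n - (c : ℚ_[2]) * RSz k n‖ ≤ ‖(2 * c : ℚ_[2])‖ := by
    intro k n
    have h1 := norm_padicLRiemannSum_twist_sub_half_le_shared f g h2N hm2 hα hμ χ hχ2 hχv hBk k n
    have h2 := translatedRiemannSumTame_one_two_eq f hm2 α hc k n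
    have hR : (c : ℚ_[2]) * RSz k n = 2 * (c : ℚ_[2]) * ∑ s : ZMod (2 ^ n), (∑ b : ZMod m, (1 : DirichletCharacter ℚ_[2] m) b *
        msdMeasureTame f m α (n + 2) ((cyclotomicGenerator 2 : ZMod (2 ^ (n + 2))) ^ s.val * (m : ZMod (2 ^ (n + 2)))) b) *
        (s.val.choose k : ℚ_[2]) := by
      rw [hRSz, hχ₁, h2]; ring
    rw [hR]
    exact h1
  -- pass to the limit
  set D : ℕ → ℚ_[2] := fun k ↦ padicLCoeff g α' k - (c : ℚ_[2]) * ℓ k with hD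
  have hDlim : ∀ k, Tendsto (fun n ↦ padicLRiemannSum g α' k n - (c : ℚ_[2]) * RSz k n) atTop (𝓝 (D k)) :=
    fun k ↦ (hTg k).sub ((hlim k).const_mul (c : ℚ_[2]))
  have hDn : ∀ k, ‖D k‖ ≤ ‖(2 * c : ℚ_[2])‖ :=
    fun k ↦ le_of_tendsto' ((hDlim k).norm) fun n ↦ hbound k n
  by_cases hc0 : c = 0
  · -- degenerate constant: everything on the right vanishes and `L₂(g) = 0` coefficientwise
    refine ⟨0, ?_⟩
    ext k
    have h : D k = padicLCoeff g α' k := by rw [hD, hc0]; simp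
    have h0 : ‖padicLCoeff g α' k‖ ≤ 0 := by
      have := hDn k; rw [h, hc0] at this; simpa using this
    rw [coeff_padicLFunction, norm_le_zero_iff.mp h0, hc0]
    simp
  · -- `E_k = D_k/(2c)`, `‖E_k‖ ≤ 1`
    have h2c : (2 * c : ℚ_[2]) ≠ 0 := mul_ne_zero two_ne_zero (by exact_mod_cast hc0)
    obtain ⟨E, hE⟩ := (exists_iwasawaToPowerSeries_eq_iff_norm_coeff_le_one (p := 2)
      (PowerSeries.mk fun k ↦ D k / (2 * c : ℚ_[2]))).mpr fun k ↦ by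
        rw [PowerSeries.coeff_mk, norm_div, div_le_one (norm_pos_iff.mpr h2c)]
        exact hDn k
    refine ⟨E, ?_⟩
    have hmd : ∀ x : ℚ_[2], (2 * c : ℚ_[2]) * (x / (2 * c)) = x := fun x ↦ by field_simp
    have hℓ' : ∀ k, (c : ℚ_[2]) * ℓ k = (c : ℚ_[2]) * ∑ i ∈ Finset.range (k + 1),
        algebraMap ℤ_[2] ℚ_[2] (Ring.choose (-frobeniusExponent 2 (m : ℤ_[2])) (k - i)) *
          coeff i (padicLFunctionTame f m α (1 : DirichletCharacter ℚ_[2] m)) := by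
      intro k
      rw [hℓ]
      congr 1
      refine Finset.sum_congr rfl fun i _ ↦ ?_
      rw [coeff_padicLFunctionTame, hχ₁]
      rfl
    ext k
    rw [map_add, coeff_padicLFunction, coeff_C_mul_binomialSeries_mul, PowerSeries.coeff_C_mul, hE, PowerSeries.coeff_mk, hmd,
      hD]
    simp only
    rw [hℓ']
    ring

end Transform

end Summit.BirchSwinnertonDyer.BirchSwinnertonDyer.Theorems.AlignedTransportAtTwoNegTwistMeasureShared

end
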